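import Summits.QuantumFields.YangMills.Theorems.LuscherReductionDressedRitzVacuumDictionary
import HarnessLib

/-!
# Route `LuscherReduction`, item `DressedRitz` (stmt-QuantumFields-20205) — the VACUUM DICTIONARY, part 2: vacuum numbers as limits of normalised
# free-boundary slab expectations (`tendsto_ratio`, `tendsto_onePoint`, `tendsto_twoPoint`, `tendsto_feynmanKac`), and vacuum subtraction

Support module of the `FemtoTransferGap` group (fleet service by seat ym-infvol-p2 g6; route `LuscherReduction`, femto rung R2b1; bears on the
crux child `DressedRitz` = stmt-QuantumFields-20205).  CONTENT = §3–§5 of the planner's crux workfile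
`Summits/QuantumFields/YangMills/Cruxes/RunningReduction/Lines/VacuumDictionary.lean` (rev 2, sha16 73f604c4d3f1017c, seat ym-cruxidea-19978-1
GEN 6; kernel-checked there) RE-HOMED VERBATIM on the Theorems side (namespace `…Theorems.FemtoTransferGap.VacDict`).

* §3 THE DICTIONARY (`tendsto_ratio`): for `l2`-bounded linear maps `A, B` of the physical subspace (identity, `K_β^t`, multiplication by a physical
  `f`, compositions — `IsL2Bounded.*`, `iterOp`, `mulOp`) and any physical `ψ` with `⟨Ω,ψ⟩ ≠ 0` (e.g. `ψ = 1`, `l2Form_vac_one_pos`):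
  `⟨A K^mψ, B K^mψ⟩ / ‖K^mψ‖² → ⟨AΩ, BΩ⟩` as `m → ∞`.
* §4 RAW COROLLARIES for the prover, `Φ_m = slabGround β m = K_β^m 1`: one-point functions `⟨Φ_m, fΦ_m⟩/‖Φ_m‖² → ⟨Ω,fΩ⟩` (`tendsto_onePoint`),
  equal-time two-point functions (`tendsto_twoPoint`), and the FEYNMAN–KAC form of a time-`t` correlator with free temporal boundary, normalised by
  the slab partition function `Z = ⟨Φ_m, K^tΦ_m⟩`: `⟨fΦ_m, K^t(gΦ_m)⟩ / ⟨Φ_m, K^tΦ_m⟩ → ⟨fΩ, K^t(gΩ)⟩ / λ₀^t` (`tendsto_feynmanKac`).  With these,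
  clause (x3) of `ExcitedPlateauAt` is the one-point function of `O_i` in the vacuum, and (x2)/(x4)/(x5)/(x6) (resp. (o2)/(o4)/(o5)/(o6) of
  `PlateauClauses`) are limits of ratios of slab path integrals with two insertions.
* §5 VACUUM SUBTRACTION MAKES (x3) EXACT: `vev Ω f = ⟨Ω, fΩ⟩`, `l2_vac_sub_vev : l2 Ω ((f − ⟨f⟩_Ω)Ω) = 0`.

HONEST FRAMING: fixed-lattice functional analysis (femto rung R2b1); no renormalisation-group content; nothing here bears on infinite volume, the
continuum or the Clay gap.  References: Reed–Simon IV Thm XIII.43–44 [cite: ReedSimonIV1978, Thm XIII.43]; E. Seiler, LNP 159 (1982) §3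
[cite: SeilerLNP1982, §3]; M. Lüscher, NPB 219 (1983) [cite: Luscher1983, §2].
-/

set_option autoImplicit false

noncomputable section

open MeasureTheory Filter Topology Real
open Literature.MathematicalPhysics.QuantumFieldTheory
open Literature.MathematicalPhysics.QuantumLattice
open Literature.Analysis.OperatorTheory.YMMatrixModel
open scoped BigOperators

namespace Summit.QuantumFields.YangMills.Theorems.FemtoTransferGap.VacDict

open Summit.QuantumFields.YangMills.Theorems.FemtoTransferGap
open Summit.QuantumFields.YangMills.Theorems.FemtoTransferGap.PhysL2
open Summit.QuantumFields.YangMills.Theorems.FemtoTransferGap.OpPlat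

variable {L : ℕ} [NeZero L]

section Vacuum

variable {β θ : ℝ} {Ω : physSubmodule L}

/-! ## §3 The dictionary: vacuum numbers as limits of normalised slab expectations -/

/-- `l2`-boundedness of a linear map of the physical subspace: `‖A x‖² ≤ M ‖x‖²` (`M ≥ 0`). [folklore] -/
def IsL2Bounded (A : physSubmodule L →ₗ[ℝ] physSubmodule L) (M : ℝ) : Prop :=
  0 ≤ M ∧ ∀ x : physSubmodule L, l2Form L (A x) (A x) ≤ M * l2Form L x x

/-- The identity is `l2`-bounded by `1`. [folklore] -/
theorem IsL2Bounded.id : IsL2Bounded (LinearMap.id : physSubmodule L →ₗ[ℝ] physSubmodule L) 1 :=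
  ⟨zero_le_one, fun x => by simp⟩

/-- `K_β` is `l2`-bounded by `λ₀²` (`β ≥ 0`). [cite: ReedSimonIV1978, Thm. XIII.1] -/
theorem IsL2Bounded.transferOp (hβ : 0 ≤ β) : IsL2Bounded (transferOp (L := L) β) (levelValue su2Rep L β 0 ^ 2) :=
  ⟨sq_nonneg _, normSq_transferOp_le hβ⟩

/-- Compositions of `l2`-bounded maps are `l2`-bounded (bounds multiply). [folklore] -/
theorem IsL2Bounded.comp {A B : physSubmodule L →ₗ[ℝ] physSubmodule L} {MA MB : ℝ} (hA : IsL2Bounded A MA)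
    (hB : IsL2Bounded B MB) : IsL2Bounded (A.comp B) (MA * MB) :=
  ⟨mul_nonneg hA.1 hB.1, fun x => by
    rw [LinearMap.comp_apply, mul_assoc]
    exact (hA.2 (B x)).trans (mul_le_mul_of_nonneg_left (hB.2 x) hA.1)⟩

/-- `K_β^t` as a linear map of the physical subspace. [folklore] -/
def iterOp (β : ℝ) : ℕ → (physSubmodule L →ₗ[ℝ] physSubmodule L)
  | 0 => LinearMap.id
  | t + 1 => (transferOp β).comp (iterOp β t)

/-- `iterOp β t x = K_β^t x`. [folklore] -/
@[simp] theorem iterOp_apply (β : ℝ) (t : ℕ) (x : physSubmodule L) :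
    iterOp (L := L) β t x = (⇑(transferOp (L := L) β))^[t] x := by
  induction t with
  | zero => rfl
  | succ t ih =>
    rw [Function.iterate_succ_apply']
    show transferOp β (iterOp β t x) = _
    rw [ih]

/-- `K_β^t` is `l2`-bounded by `λ₀^{2t}`. [cite: ReedSimonIV1978, Thm. XIII.1] -/
theorem IsL2Bounded.iterOp (hβ : 0 ≤ β) (t : ℕ) :
    IsL2Bounded (iterOp (L := L) β t) ((levelValue su2Rep L β 0 ^ 2) ^ t) := by
  induction t with
  | zero =>
    rw [pow_zero]
    exact IsL2Bounded.id (L := L)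
  | succ t ih =>
    rw [pow_succ']
    exact (IsL2Bounded.transferOp hβ).comp ih

/-- `iterOp` on raw functions: `↑(K_β^t y) = (transferApply β)^[t] ↑y`. [folklore] -/
theorem coe_iterOp (β : ℝ) (t : ℕ) (y : physSubmodule L) :
    ((iterOp (L := L) β t y : physSubmodule L) : GaugeConfig 3 L SU2 → ℝ) =
      (transferApply β)^[t] (y : GaugeConfig 3 L SU2 → ℝ) := by
  rw [iterOp_apply, coe_iterate_transferOp]

/-- **Multiplication by a physical test function** `f` as a linear map of the physical subspace (`x ↦ f·x`; an «operator insertion at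
one time slice»). [folklore] -/
def mulOp (f : GaugeConfig 3 L SU2 → ℝ) (hf : IsPhys f) : physSubmodule L →ₗ[ℝ] physSubmodule L where
  toFun x := ⟨f * (x : GaugeConfig 3 L SU2 → ℝ), isPhys_mul hf x.2⟩
  map_add' x y := by
    apply Subtype.ext
    simp only [Submodule.coe_add]
    exact mul_add _ _ _
  map_smul' c x := by
    apply Subtype.ext
    simp only [Submodule.coe_smul, RingHom.id_apply]
    funext U
    simp only [Pi.mul_apply, Pi.smul_apply, smul_eq_mul]
    ring

omit [NeZero L] in
/-- `mulOp` unfolded. [folklore] -/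
@[simp] theorem coe_mulOp {f : GaugeConfig 3 L SU2 → ℝ} (hf : IsPhys f) (x : physSubmodule L) :
    ((mulOp f hf x : physSubmodule L) : GaugeConfig 3 L SU2 → ℝ) = f * (x : GaugeConfig 3 L SU2 → ℝ) := rfl

/-- Multiplication by `f` with `|f| ≤ C` is `l2`-bounded by `C²`. [folklore] -/
theorem IsL2Bounded.mulOp {f : GaugeConfig 3 L SU2 → ℝ} (hf : IsPhys f) {C : ℝ} (hC : ∀ U, |f U| ≤ C) :
    IsL2Bounded (mulOp (L := L) f hf) (C ^ 2) :=
  ⟨sq_nonneg _, fun x => by rw [l2Form_apply, l2Form_apply, coe_mulOp]; exact l2_mul_self_le hf x.2 hC⟩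

/-- Square-root form of an `l2` bound: `√‖Ax‖² ≤ √M · √‖x‖²`. [folklore] -/
theorem IsL2Bounded.sqrt_le {A : physSubmodule L →ₗ[ℝ] physSubmodule L} {M : ℝ} (hA : IsL2Bounded A M) (x : physSubmodule L) :
    Real.sqrt (l2Form L (A x) (A x)) ≤ Real.sqrt M * Real.sqrt (l2Form L x x) := by
  rw [← Real.sqrt_mul hA.1]
  exact Real.sqrt_le_sqrt (hA.2 x)

/-- Cauchy–Schwarz in the `physSubmodule` currency. [folklore] -/
theorem abs_l2Form_le (x y : physSubmodule L) :
    |l2Form L x y| ≤ Real.sqrt (l2Form L x x) * Real.sqrt (l2Form L y y) :=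
  abs_l2_le_sqrt_mul_sqrt (isPhys_coe x) (isPhys_coe y)

/-- Continuity estimate for the bilinear functional `e ↦ ⟨A(Ω+e), B(Ω+e)⟩` at `e = 0` (`‖Ω‖ = 1`):
`|⟨A(Ω+e),B(Ω+e)⟩ − ⟨AΩ,BΩ⟩| ≤ √MA √MB (2√‖e‖² + ‖e‖²)`. [folklore] -/
theorem abs_bilin_sub_le (hV : IsVacuum β Ω θ) {A B : physSubmodule L →ₗ[ℝ] physSubmodule L} {MA MB : ℝ}
    (hA : IsL2Bounded A MA) (hB : IsL2Bounded B MB) (e : physSubmodule L) :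
    |l2Form L (A (Ω + e)) (B (Ω + e)) - l2Form L (A Ω) (B Ω)| ≤
      Real.sqrt MA * Real.sqrt MB * (2 * Real.sqrt (l2Form L e e) + l2Form L e e) := by
  set s := l2Form L e e with hs
  have hs0 : 0 ≤ s := l2Form_self_nonneg _
  have hΩ1 : Real.sqrt (l2Form L Ω Ω) = 1 := by rw [hV.norm_one, Real.sqrt_one]
  have hexp : l2Form L (A (Ω + e)) (B (Ω + e)) - l2Form L (A Ω) (B Ω) =
      l2Form L (A Ω) (B e) + l2Form L (A e) (B Ω) + l2Form L (A e) (B e) := by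
    simp only [map_add, LinearMap.add_apply]; ring
  rw [hexp]
  have hMA : 0 ≤ Real.sqrt MA := Real.sqrt_nonneg _
  have hMB : 0 ≤ Real.sqrt MB := Real.sqrt_nonneg _
  have t1 : |l2Form L (A Ω) (B e)| ≤ Real.sqrt MA * Real.sqrt MB * Real.sqrt s := by
    refine (abs_l2Form_le _ _).trans ?_
    calc Real.sqrt (l2Form L (A Ω) (A Ω)) * Real.sqrt (l2Form L (B e) (B e))
        ≤ (Real.sqrt MA * Real.sqrt (l2Form L Ω Ω)) * (Real.sqrt MB * Real.sqrt s) :=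
          mul_le_mul (hA.sqrt_le Ω) (hB.sqrt_le e) (Real.sqrt_nonneg _) (by positivity)
      _ = Real.sqrt MA * Real.sqrt MB * Real.sqrt s := by rw [hΩ1]; ring
  have t2 : |l2Form L (A e) (B Ω)| ≤ Real.sqrt MA * Real.sqrt MB * Real.sqrt s := by
    refine (abs_l2Form_le _ _).trans ?_
    calc Real.sqrt (l2Form L (A e) (A e)) * Real.sqrt (l2Form L (B Ω) (B Ω))
        ≤ (Real.sqrt MA * Real.sqrt s) * (Real.sqrt MB * Real.sqrt (l2Form L Ω Ω)) :=
          mul_le_mul (hA.sqrt_le e) (hB.sqrt_le Ω) (Real.sqrt_nonneg _) (by positivity)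
      _ = Real.sqrt MA * Real.sqrt MB * Real.sqrt s := by rw [hΩ1]; ring
  have t3 : |l2Form L (A e) (B e)| ≤ Real.sqrt MA * Real.sqrt MB * s := by
    refine (abs_l2Form_le _ _).trans ?_
    calc Real.sqrt (l2Form L (A e) (A e)) * Real.sqrt (l2Form L (B e) (B e))
        ≤ (Real.sqrt MA * Real.sqrt s) * (Real.sqrt MB * Real.sqrt s) :=
          mul_le_mul (hA.sqrt_le e) (hB.sqrt_le e) (Real.sqrt_nonneg _) (by positivity)
      _ = Real.sqrt MA * Real.sqrt MB * (Real.sqrt s * Real.sqrt s) := by ring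
      _ = Real.sqrt MA * Real.sqrt MB * s := by rw [Real.mul_self_sqrt hs0]
  calc |l2Form L (A Ω) (B e) + l2Form L (A e) (B Ω) + l2Form L (A e) (B e)|
      ≤ |l2Form L (A Ω) (B e)| + |l2Form L (A e) (B Ω)| + |l2Form L (A e) (B e)| := abs_add_three _ _ _
    _ ≤ Real.sqrt MA * Real.sqrt MB * Real.sqrt s + Real.sqrt MA * Real.sqrt MB * Real.sqrt s +
          Real.sqrt MA * Real.sqrt MB * s := add_le_add (add_le_add t1 t2) t3
    _ = Real.sqrt MA * Real.sqrt MB * (2 * Real.sqrt s + s) := by ring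

/-- ★ **THE VACUUM DICTIONARY (power iteration ∕ transfer-matrix form of Feynman–Kac with free temporal boundary).**  For the vacuum package
`(Ω, θ)` at `β ≥ 0`, `l2`-bounded linear maps `A, B` of the physical subspace, and any physical `ψ` with `⟨Ω, ψ⟩ ≠ 0`:
`⟨A K_β^m ψ, B K_β^m ψ⟩ / ‖K_β^m ψ‖² → ⟨AΩ, BΩ⟩` as `m → ∞` (rate `(θ/λ₀)^m`).  With `ψ = 1` the vectors `K_β^m 1 = Φ_m` are the free-boundary
slabs, and the left side is a ratio of two slab path integrals. [cite: ReedSimonIV1978, Thm XIII.43 and Thm XIII.44] -/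
theorem tendsto_ratio (hV : IsVacuum β Ω θ) (hβ : 0 ≤ β) {A B : physSubmodule L →ₗ[ℝ] physSubmodule L} {MA MB : ℝ}
    (hA : IsL2Bounded A MA) (hB : IsL2Bounded B MB) (ψ : physSubmodule L) (ha : l2Form L Ω ψ ≠ 0) :
    Tendsto (fun m : ℕ => l2Form L (A ((⇑(transferOp (L := L) β))^[m] ψ)) (B ((⇑(transferOp β))^[m] ψ)) /
        l2Form L ((⇑(transferOp β))^[m] ψ) ((⇑(transferOp β))^[m] ψ)) atTop (𝓝 (l2Form L (A Ω) (B Ω))) := by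
  set lam := levelValue su2Rep L β 0 with hlam_def
  have hlam : 0 < lam := levelValue_zero_su2Rep_pos L β
  set a := l2Form L Ω ψ with ha_def
  set c : ℕ → ℝ := fun m => a * lam ^ m with hc
  have hc0 : ∀ m, c m ≠ 0 := fun m => mul_ne_zero ha (pow_ne_zero _ hlam.ne')
  -- the normalised error vectors `e m`, with `K^m ψ = c m • (Ω + e m)`
  set e : ℕ → physSubmodule L := fun m => (c m)⁻¹ • ((⇑(transferOp β))^[m] ψ - c m • Ω) with he
  have hE : ∀ m, (⇑(transferOp (L := L) β))^[m] ψ = c m • (Ω + e m) := by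
    intro m
    simp only [he, smul_add, smul_sub, smul_smul, mul_inv_cancel₀ (hc0 m), inv_mul_cancel₀ (hc0 m), one_smul]
    abel
  -- `‖e m‖² → 0` geometrically
  set s : ℕ → ℝ := fun m => l2Form L (e m) (e m) with hs
  have hs0 : ∀ m, 0 ≤ s m := fun m => l2Form_self_nonneg _
  have hs_le : ∀ m, s m ≤ ((θ / lam) ^ 2) ^ m * (l2Form L ψ ψ / a ^ 2) := by
    intro m
    have h1 := normSq_iterate_sub_le hV hβ ψ m
    have hsm : s m = ((c m)⁻¹) ^ 2 *
        l2Form L ((⇑(transferOp β))^[m] ψ - c m • Ω) ((⇑(transferOp β))^[m] ψ - c m • Ω) := by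
      simp only [hs, he, map_smul, LinearMap.smul_apply, smul_eq_mul]
      ring
    rw [hsm]
    calc ((c m)⁻¹) ^ 2 * l2Form L ((⇑(transferOp β))^[m] ψ - c m • Ω) ((⇑(transferOp β))^[m] ψ - c m • Ω)
        ≤ ((c m)⁻¹) ^ 2 * (θ ^ (2 * m) * l2Form L ψ ψ) := mul_le_mul_of_nonneg_left h1 (sq_nonneg _)
      _ = ((θ / lam) ^ 2) ^ m * (l2Form L ψ ψ / a ^ 2) := by
          simp only [hc]
          rw [inv_pow, inv_mul_eq_div, ← pow_mul, div_pow, div_mul_div_comm]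
          congr 1
          ring
  have hr1 : (θ / lam) ^ 2 < 1 := by
    have h01 : 0 ≤ θ / lam := div_nonneg hV.theta_nonneg hlam.le
    have hlt : θ / lam < 1 := (div_lt_one hlam).mpr hV.theta_lt
    nlinarith
  have hs_tend : Tendsto s atTop (𝓝 0) := by
    have hg := (tendsto_pow_atTop_nhds_zero_of_lt_one (sq_nonneg (θ / lam)) hr1).mul_const (l2Form L ψ ψ / a ^ 2)
    rw [zero_mul] at hg
    exact squeeze_zero hs0 hs_le hg
  have hsq_tend : Tendsto (fun m => Real.sqrt (s m)) atTop (𝓝 0) := by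
    simpa using hs_tend.sqrt
  have hg_tend : ∀ K : ℝ, Tendsto (fun m => K * (2 * Real.sqrt (s m) + s m)) atTop (𝓝 0) := by
    intro K
    have := ((hsq_tend.const_mul 2).add hs_tend).const_mul K
    simpa using this
  -- numerator and denominator after removing the common factor `c m ^ 2`
  set u : ℕ → ℝ := fun m => l2Form L (A (Ω + e m)) (B (Ω + e m)) with hu
  set v : ℕ → ℝ := fun m => l2Form L (Ω + e m) (Ω + e m) with hv
  have hu_tend : Tendsto u atTop (𝓝 (l2Form L (A Ω) (B Ω))) := by
    rw [tendsto_iff_norm_sub_tendsto_zero]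
    refine squeeze_zero (fun m => norm_nonneg _) (fun m => ?_) (hg_tend (Real.sqrt MA * Real.sqrt MB))
    rw [Real.norm_eq_abs]
    exact abs_bilin_sub_le hV hA hB (e m)
  have hv_tend : Tendsto v atTop (𝓝 1) := by
    rw [tendsto_iff_norm_sub_tendsto_zero]
    refine squeeze_zero (fun m => norm_nonneg _) (fun m => ?_) (hg_tend (Real.sqrt 1 * Real.sqrt 1))
    rw [Real.norm_eq_abs]
    have h := abs_bilin_sub_le hV (IsL2Bounded.id (L := L)) (IsL2Bounded.id (L := L)) (e m)
    simp only [LinearMap.id_coe, id_eq, hV.norm_one] at h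
    exact h
  -- the ratio equals `u m / v m`
  have hratio : ∀ m, l2Form L (A ((⇑(transferOp (L := L) β))^[m] ψ)) (B ((⇑(transferOp β))^[m] ψ)) /
      l2Form L ((⇑(transferOp β))^[m] ψ) ((⇑(transferOp β))^[m] ψ) = u m / v m := by
    intro m
    rw [hE m]
    simp only [map_smul, LinearMap.smul_apply, smul_eq_mul, hu, hv]
    rw [mul_div_mul_left _ _ (hc0 m), mul_div_mul_left _ _ (hc0 m)]
  rw [show (fun m : ℕ => l2Form L (A ((⇑(transferOp (L := L) β))^[m] ψ)) (B ((⇑(transferOp β))^[m] ψ)) /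
      l2Form L ((⇑(transferOp β))^[m] ψ) ((⇑(transferOp β))^[m] ψ)) = fun m => u m / v m from funext hratio]
  have := hu_tend.div hv_tend one_ne_zero
  rw [div_one] at this
  exact this

/-! ## §4 Raw corollaries for the prover: slabs `Φ_m = slabGround β m = K_β^m 1` -/

/-- The constant test function `1` as an element of the physical subspace. [folklore] -/
def one : physSubmodule L := ⟨fun _ => 1, isPhys_const 1⟩

omit [NeZero L] in
/-- `1` unfolded. [folklore] -/
@[simp] theorem coe_one : ((one : physSubmodule L) : GaugeConfig 3 L SU2 → ℝ) = fun _ => 1 := rfl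

/-- `K_β^m 1 = Φ_m` (the free-boundary slab of `m` layers). [folklore] -/
theorem coe_iterate_one (β : ℝ) (m : ℕ) :
    (((⇑(transferOp (L := L) β))^[m] one : physSubmodule L) : GaugeConfig 3 L SU2 → ℝ) = slabGround (L := L) β m := by
  rw [coe_iterate_transferOp]
  rfl

/-- `⟨Ω, 1⟩ = ∫Ω > 0` for a uniformly positive vacuum (`exists_isVacuum`): the slabs `Φ_m` are admissible start vectors. [folklore] -/
theorem l2Form_vac_one_pos {Ω : physSubmodule L} {c : ℝ} (hc : 0 < c) (hcle : ∀ U, c ≤ (Ω : GaugeConfig 3 L SU2 → ℝ) U) :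
    0 < l2Form L Ω one := by
  rw [l2Form_apply]
  exact l2_pos_of_le (isPhys_coe Ω) (isPhys_const 1) hc one_pos hcle (fun _ => le_rfl)

/-- **ONE-POINT FUNCTIONS**: `⟨Φ_m, f Φ_m⟩ / ‖Φ_m‖² → ⟨Ω, fΩ⟩` — the vacuum expectation of the insertion `f` is the limit of its free-boundary
slab expectation at the middle slice (`⟨K^m1, f K^m 1⟩ / ⟨K^m 1, K^m 1⟩`, slab of `2m` layers).  This is clause (x3) of `ExcitedPlateau` for
`w = fΩ/‖fΩ‖`. [cite: SeilerLNP1982, §3] -/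
theorem tendsto_onePoint (hV : IsVacuum β Ω θ) (hβ : 0 ≤ β) (hΩ1 : l2Form L Ω one ≠ 0) {f : GaugeConfig 3 L SU2 → ℝ}
    (hf : IsPhys f) :
    Tendsto (fun m : ℕ => l2 (slabGround (L := L) β m) (f * slabGround β m) / l2 (slabGround (L := L) β m) (slabGround β m))
      atTop (𝓝 (l2 (Ω : GaugeConfig 3 L SU2 → ℝ) (f * (Ω : GaugeConfig 3 L SU2 → ℝ)))) := by
  obtain ⟨C, hC⟩ := hf.bounded
  have h := tendsto_ratio hV hβ (IsL2Bounded.id (L := L)) (IsL2Bounded.mulOp hf hC) one hΩ1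
  simp only [LinearMap.id_coe, id_eq, l2Form_apply, coe_mulOp, coe_iterate_one] at h
  exact h

/-- **FEYNMAN–KAC, free temporal boundary**: the time-`t` two-point function of insertions `f`, `g` in a slab of `2m + t` layers, normalised
by the slab partition function, converges to the vacuum correlator:
`⟨fΦ_m, K_β^t(gΦ_m)⟩ / ⟨Φ_m, K_β^tΦ_m⟩ → ⟨fΩ, K_β^t(gΩ)⟩ / λ₀^t` as `m → ∞` (`t = 0`: equal-time two-point functions, norms `‖fΩ‖²`;
`t = 1, 2`: the diagonal values and one-step residuals of (x4)/(x5)/(x6) of `ExcitedPlateau` for `w = fΩ/‖fΩ‖`).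
[cite: SeilerLNP1982, §3] [cite: Luscher1983] -/
theorem tendsto_feynmanKac (hV : IsVacuum β Ω θ) (hβ : 0 ≤ β) (hΩ1 : l2Form L Ω one ≠ 0)
    {f g : GaugeConfig 3 L SU2 → ℝ} (hf : IsPhys f) (hg : IsPhys g) (t : ℕ) :
    Tendsto (fun m : ℕ =>
        l2 (f * slabGround (L := L) β m) ((transferApply β)^[t] (g * slabGround β m)) /
          l2 (slabGround (L := L) β m) ((transferApply β)^[t] (slabGround β m)))
      atTop (𝓝 (l2 (f * (Ω : GaugeConfig 3 L SU2 → ℝ)) ((transferApply β)^[t] (g * (Ω : GaugeConfig 3 L SU2 → ℝ))) /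
        levelValue su2Rep L β 0 ^ t)) := by
  obtain ⟨C, hC⟩ := hf.bounded
  obtain ⟨D, hD⟩ := hg.bounded
  have hlam : 0 < levelValue su2Rep L β 0 := levelValue_zero_su2Rep_pos L β
  -- numerator ratio
  have hN := tendsto_ratio hV hβ (IsL2Bounded.mulOp hf hC) ((IsL2Bounded.iterOp hβ t).comp (IsL2Bounded.mulOp hg hD)) one hΩ1
  -- denominator ratio
  have hD' := tendsto_ratio hV hβ (IsL2Bounded.id (L := L)) (IsL2Bounded.iterOp hβ t) one hΩ1
  simp only [LinearMap.id_coe, id_eq] at hD'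
  have hlim : l2Form L Ω (iterOp (L := L) β t Ω) = levelValue su2Rep L β 0 ^ t := by
    rw [iterOp_apply, iterate_vac hV, map_smul, smul_eq_mul, hV.norm_one, mul_one]
  rw [hlim] at hD'
  have hq := hN.div hD' (pow_ne_zero _ hlam.ne')
  simp only [LinearMap.comp_apply, l2Form_apply, coe_mulOp, coe_iterOp, coe_iterate_one] at hq
  refine hq.congr fun m => ?_
  have hz : l2 (slabGround (L := L) β m) (slabGround β m) ≠ 0 := (l2_slabGround_pos β m).ne'
  simp only [Pi.div_apply]
  rw [div_div_div_cancel_right₀ hz]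

/-- **EQUAL-TIME TWO-POINT FUNCTIONS** (`t = 0` of `tendsto_feynmanKac`): `⟨fΦ_m, gΦ_m⟩ / ‖Φ_m‖² → ⟨fΩ, gΩ⟩`; with `g = f` the norms
`‖fΩ‖²` normalising the witnesses `w = fΩ/‖fΩ‖` of `ExcitedPlateau`, with `f ≠ g` their overlaps (x2). [cite: SeilerLNP1982, §3] -/
theorem tendsto_twoPoint (hV : IsVacuum β Ω θ) (hβ : 0 ≤ β) (hΩ1 : l2Form L Ω one ≠ 0)
    {f g : GaugeConfig 3 L SU2 → ℝ} (hf : IsPhys f) (hg : IsPhys g) :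
    Tendsto (fun m : ℕ => l2 (f * slabGround (L := L) β m) (g * slabGround β m) / l2 (slabGround (L := L) β m) (slabGround β m))
      atTop (𝓝 (l2 (f * (Ω : GaugeConfig 3 L SU2 → ℝ)) (g * (Ω : GaugeConfig 3 L SU2 → ℝ)))) := by
  simpa using tendsto_feynmanKac hV hβ hΩ1 hf hg 0

/-! ## §5 Vacuum subtraction makes clause (x3) EXACT -/

/-- The vacuum expectation value `⟨f⟩_Ω = ⟨Ω, fΩ⟩` of an insertion `f` (the limit in `tendsto_onePoint`). [folklore] -/
def vev (Ω : physSubmodule L) (f : GaugeConfig 3 L SU2 → ℝ) : ℝ :=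
  l2 (Ω : GaugeConfig 3 L SU2 → ℝ) (f * (Ω : GaugeConfig 3 L SU2 → ℝ))

/-- `tendsto_onePoint` restated: `⟨Φ_m, fΦ_m⟩/‖Φ_m‖² → ⟨f⟩_Ω`. [cite: SeilerLNP1982, §3] -/
theorem tendsto_onePoint_vev (hV : IsVacuum β Ω θ) (hβ : 0 ≤ β) (hΩ1 : l2Form L Ω one ≠ 0) {f : GaugeConfig 3 L SU2 → ℝ}
    (hf : IsPhys f) :
    Tendsto (fun m : ℕ => l2 (slabGround (L := L) β m) (f * slabGround β m) / l2 (slabGround (L := L) β m) (slabGround β m))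
      atTop (𝓝 (vev Ω f)) :=
  tendsto_onePoint hV hβ hΩ1 hf

omit [NeZero L] in
/-- The vacuum-subtracted insertion as a linear map: `(f − c)·x = f·x − c•x`. [folklore] -/
theorem mulOp_sub_const {f : GaugeConfig 3 L SU2 → ℝ} (hf : IsPhys f) (c : ℝ) (x : physSubmodule L) :
    mulOp (f - fun _ => c) (isPhys_sub hf (isPhys_const c)) x = mulOp f hf x - c • x := by
  apply Subtype.ext
  simp only [coe_mulOp, Submodule.coe_sub, Submodule.coe_smul]
  funext U
  simp only [Pi.mul_apply, Pi.sub_apply, Pi.smul_apply, smul_eq_mul]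
  ring

/-- ★ **(x3) is exact after vacuum subtraction**: `⟨Ω, (f − ⟨f⟩_Ω)Ω⟩ = 0`.  Hence the natural witnesses `w = (f − ⟨f⟩_Ω)Ω/‖(f − ⟨f⟩_Ω)Ω‖` of
`KTGen.ExcitedPlateau` satisfy clause (x3) with ANY constant `C ≥ 0`; no estimate is needed there. [folklore] -/
theorem l2Form_vac_mulOp_sub_vev (hV : IsVacuum β Ω θ) {f : GaugeConfig 3 L SU2 → ℝ} (hf : IsPhys f) :
    l2Form L Ω (mulOp (f - fun _ => vev Ω f) (isPhys_sub hf (isPhys_const _)) Ω) = 0 := by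
  rw [mulOp_sub_const hf, map_sub, map_smul, smul_eq_mul, hV.norm_one, mul_one, l2Form_apply, coe_mulOp]
  exact sub_self _

/-- Raw form of `l2Form_vac_mulOp_sub_vev`: `l2 Ω ((f − ⟨f⟩_Ω)·Ω) = 0`. [folklore] -/
theorem l2_vac_sub_vev (hV : IsVacuum β Ω θ) {f : GaugeConfig 3 L SU2 → ℝ} (hf : IsPhys f) :
    l2 (Ω : GaugeConfig 3 L SU2 → ℝ) ((f - fun _ => vev Ω f) * (Ω : GaugeConfig 3 L SU2 → ℝ)) = 0 := by
  have h := l2Form_vac_mulOp_sub_vev hV hf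
  rwa [l2Form_apply, coe_mulOp] at h

end Vacuum


end Summit.QuantumFields.YangMills.Theorems.FemtoTransferGap.VacDict

end
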